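import Summits.AnomalousDissipation.AnomalousDissipation.Theorems.SoloBlindReynoldsProduction

/-!
# Inertial energy floor for steady states under a fixed force (solo soloist, blind mode)

Smooth steady states `(U, P)` of `NS_ν(f)` on `T^d` (`Torus.IsSteadyNSState ν f U P`) with a FIXED
smooth divergence-free force `f`. Testing the steady momentum equation against `f` itself (the
pressure drops out because `div f = 0`) pins one quadratic moment of `U`:

* `force_sq_eq`: `∫‖f‖² = −∫⟪(U·∇)f, U⟫ − ν ∫⟪U, Δf⟫` — the flow must be anti-correlated with
  the strain of the force, by exactly `‖f‖₂²` up to a viscous correction.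
* `force_sq_le_strain_mul_energy`: hence `∫‖f‖² ≤ M ∫‖U‖² + |ν| √(∫‖U‖² · ∫‖Δf‖²)` whenever
  `|∇f| ≤ M` pointwise (Frobenius norm): the steady-state form, with the explicit constant
  `M = sup |∇f|`, of the Doering–Foias amplitude bound `F ≤ a U²/ℓ + b ν U/ℓ²` (Doering–Foias 2002,
  §3; in the tree for Leray–Hopf solutions as `DoeringFoias2002_amplitude_le`).
* `force_sq_le_strain_mul_energy_bound`: along any vanishing-viscosity steady family with
  `∫‖Uⱼ‖² ≤ E₀` one gets `∫‖f‖² ≤ M · E₀` — an INERTIAL ENERGY FLOOR `E₀ ≥ ‖f‖₂²/sup|∇f|`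
  (`U² ≳ |f| ℓ_f`), uniform in the viscosity: bounded-energy steady families cannot be small, and
  (with `dissipation_le`) a steady zeroth-law witness has its energy pinned in
  `[‖f‖₂²/M, E₀]` and `ε² ≤ ‖f‖₂² E₀ ≤ M E₀²` (`dissipation_floor_sq_le`).
[cite: DoeringFoias2002, §3] [cite: Temam1984, Ch. II §1.2 Lemma 1.3]
-/

open MeasureTheory Filter Topology Set
open scoped ENNReal NNReal InnerProductSpace

noncomputable section

namespace Summit.AnomalousDissipation.AnomalousDissipation.Theorems

open Literature.Analysis.FunctionSpaces Literature.Analysis.FluidPDE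

variable {d : Type*} [Fintype d] [DecidableEq d]

omit [DecidableEq d] in
/-- Continuous real functions on the compact torus are integrable. [folklore] -/
private theorem integrable_of_continuous_torus₂ {g : UnitAddTorus d → ℝ} (hg : Continuous g) :
    Integrable g volume :=
  hg.integrable_of_hasCompactSupport (HasCompactSupport.of_compactSpace g)

omit [DecidableEq d] in
/-- Cauchy–Schwarz for the `L²` pairing of two continuous fields on the torus:
`|∫⟪a, b⟫| ≤ √(∫‖a‖² · ∫‖b‖²)`. [folklore] -/
private theorem abs_integral_inner_le_sqrt {a b : UnitAddTorus d → EuclideanSpace ℝ d}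
    (ha : Continuous a) (hb : Continuous b) :
    |∫ x, ⟪a x, b x⟫_ℝ| ≤ Real.sqrt ((∫ x, ‖a x‖ ^ 2) * ∫ x, ‖b x‖ ^ 2) := by
  have hE : Integrable (fun x => ‖a x‖ ^ 2) volume := integrable_of_continuous_torus₂ (ha.norm.pow 2)
  have hL : Integrable (fun x => ‖b x‖ ^ 2) volume := integrable_of_continuous_torus₂ (hb.norm.pow 2)
  refine abs_integral_le_integral_abs.trans ?_
  refine integral_le_sqrt_integral_mul_integral (ae_of_all _ fun x => abs_nonneg _)
    (ae_of_all _ fun x => sq_nonneg _) (ae_of_all _ fun x => sq_nonneg _)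
    (ae_of_all _ fun x => ?_) (ha.inner hb).abs.aestronglyMeasurable hE hL
  rw [← mul_pow]
  exact pow_le_pow_left₀ (abs_nonneg _) (abs_real_inner_le_norm _ _) 2

/-- **The force moment identity.** For a smooth steady state of `NS_ν(f)` with smooth
divergence-free `f`: `∫‖f‖² = −∫⟪(U·∇)f, U⟫ − ν ∫⟪U, Δf⟫` (test the steady equation with `f`,
`work_on_test_field`, and use the antisymmetry `∫⟪(U·∇)U, f⟫ = −∫⟪(U·∇)f, U⟫`,
Temam 1984 Ch. II Lemma 1.3). [cite: Temam1984, Ch. II §1.2 Lemma 1.3] -/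
theorem force_sq_eq {ν : ℝ} {f U : UnitAddTorus d → EuclideanSpace ℝ d} {P : UnitAddTorus d → ℝ}
    (h : Torus.IsSteadyNSState ν f U P) (hf : Torus.IsSmooth f) (hfd : Torus.IsDivFree f) :
    ∫ x, ‖f x‖ ^ 2 =
      -(∫ x, ⟪Torus.convect U f x, U x⟫_ℝ) - ν * ∫ x, ⟪U x, Torus.laplacian f x⟫_ℝ := by
  have hU : Torus.IsSmooth U :=
    (Torus.IsClassicalNSSolutionOn.smooth_velocity h).isSmooth_slice (mem_univ (0 : ℝ))
  have hUd : Torus.IsDivFree U := Torus.IsClassicalNSSolutionOn.divFree h 0 (mem_univ (0 : ℝ))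
  have hw := work_on_test_field h hf hfd
  have hff : ∫ x, ⟪f x, f x⟫_ℝ = ∫ x, ‖f x‖ ^ 2 :=
    integral_congr_ae (ae_of_all _ fun x => real_inner_self_eq_norm_sq (f x))
  have hanti : ∫ x, ⟪Torus.convect U U x, f x⟫_ℝ = -∫ x, ⟪Torus.convect U f x, U x⟫_ℝ := by
    rw [Torus.integral_inner_convect_eq_neg hU hUd hU hf]
    congr 1
    exact integral_congr_ae (ae_of_all _ fun x => real_inner_comm _ _)
  rw [← hff, hw, hanti]

/-- **Force amplitude ≤ strain × energy** (steady form of the Doering–Foias amplitude bound, with the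
explicit constant `M = sup |∇f|`): if `(∑ᵢ ‖∂ᵢ f(x)‖²)^{1/2} ≤ M` on `T^d` then
`∫‖f‖² ≤ M ∫‖U‖² + |ν| √(∫‖U‖² · ∫‖Δf‖²)`. [cite: DoeringFoias2002, §3] -/
theorem force_sq_le_strain_mul_energy {ν : ℝ} {f U : UnitAddTorus d → EuclideanSpace ℝ d}
    {P : UnitAddTorus d → ℝ} {M : ℝ} (h : Torus.IsSteadyNSState ν f U P) (hf : Torus.IsSmooth f)
    (hfd : Torus.IsDivFree f) (hM : ∀ x, Real.sqrt (∑ i, ‖Torus.partialDeriv i f x‖ ^ 2) ≤ M) :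
    ∫ x, ‖f x‖ ^ 2 ≤
      M * (∫ x, ‖U x‖ ^ 2) +
        |ν| * Real.sqrt ((∫ x, ‖U x‖ ^ 2) * ∫ x, ‖Torus.laplacian f x‖ ^ 2) := by
  have hU : Torus.IsSmooth U :=
    (Torus.IsClassicalNSSolutionOn.smooth_velocity h).isSmooth_slice (mem_univ (0 : ℝ))
  rw [force_sq_eq h hf hfd]
  have h1 : -(∫ x, ⟪Torus.convect U f x, U x⟫_ℝ) ≤ M * (∫ x, ‖U x‖ ^ 2) :=
    (neg_le_abs _).trans (abs_production_le hU hf hM)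
  have hcs := abs_integral_inner_le_sqrt hU.continuous hf.laplacian.continuous
  have h2 : -(ν * ∫ x, ⟪U x, Torus.laplacian f x⟫_ℝ) ≤
      |ν| * Real.sqrt ((∫ x, ‖U x‖ ^ 2) * ∫ x, ‖Torus.laplacian f x‖ ^ 2) :=
    calc -(ν * ∫ x, ⟪U x, Torus.laplacian f x⟫_ℝ) ≤ |ν * ∫ x, ⟪U x, Torus.laplacian f x⟫_ℝ| :=
          neg_le_abs _
      _ = |ν| * |∫ x, ⟪U x, Torus.laplacian f x⟫_ℝ| := abs_mul _ _
      _ ≤ |ν| * Real.sqrt ((∫ x, ‖U x‖ ^ 2) * ∫ x, ‖Torus.laplacian f x‖ ^ 2) :=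
          mul_le_mul_of_nonneg_left hcs (abs_nonneg _)
  linarith

/-- **Inertial energy floor, uniform in the viscosity.** Along a family of smooth steady states
`Uⱼ` of `NS_{νⱼ}(f)` with `νⱼ → 0`, one fixed smooth divergence-free `f` with `|∇f| ≤ M`, and
`∫‖Uⱼ‖² ≤ E₀` for all `j`: `∫‖f‖² ≤ M · E₀`, i.e. `E₀ ≥ ‖f‖₂² / sup|∇f|` (`U² ≳ |f| ℓ_f`:
bounded-energy steady families are inertia-dominated from below; Doering–Foias 2002 §3, `U² ≳ Fℓ`
for `Re ≥ 1`). [cite: DoeringFoias2002, §3] -/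
theorem force_sq_le_strain_mul_energy_bound {ν : ℕ → ℝ} {f : UnitAddTorus d → EuclideanSpace ℝ d}
    {U : ℕ → UnitAddTorus d → EuclideanSpace ℝ d} {P : ℕ → UnitAddTorus d → ℝ} {E₀ M : ℝ}
    (h : ∀ j, Torus.IsSteadyNSState (ν j) f (U j) (P j)) (hf : Torus.IsSmooth f)
    (hfd : Torus.IsDivFree f) (hM : ∀ x, Real.sqrt (∑ i, ‖Torus.partialDeriv i f x‖ ^ 2) ≤ M)
    (hν₀ : Tendsto ν atTop (𝓝 0)) (hE : ∀ j, ∫ x, ‖U j x‖ ^ 2 ≤ E₀) :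
    ∫ x, ‖f x‖ ^ 2 ≤ M * E₀ := by
  have hM0 : 0 ≤ M := (Real.sqrt_nonneg _).trans (hM 0)
  set L := ∫ x, ‖Torus.laplacian f x‖ ^ 2 with hL_def
  have hL0 : 0 ≤ L := integral_nonneg fun x => sq_nonneg _
  have hj : ∀ j, (∫ x, ‖f x‖ ^ 2) ≤ M * E₀ + |ν j| * Real.sqrt (E₀ * L) := by
    intro j
    have hb := force_sq_le_strain_mul_energy (h j) hf hfd hM
    have hs : Real.sqrt ((∫ x, ‖U j x‖ ^ 2) * L) ≤ Real.sqrt (E₀ * L) :=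
      Real.sqrt_le_sqrt (mul_le_mul_of_nonneg_right (hE j) hL0)
    have h1 : M * (∫ x, ‖U j x‖ ^ 2) ≤ M * E₀ := mul_le_mul_of_nonneg_left (hE j) hM0
    have h2 : |ν j| * Real.sqrt ((∫ x, ‖U j x‖ ^ 2) * L) ≤ |ν j| * Real.sqrt (E₀ * L) :=
      mul_le_mul_of_nonneg_left hs (abs_nonneg _)
    linarith
  have hν' : Tendsto (fun j => |ν j|) atTop (𝓝 0) := by simpa using hν₀.abs
  have ht : Tendsto (fun j => M * E₀ + |ν j| * Real.sqrt (E₀ * L)) atTop (𝓝 (M * E₀)) := by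
    simpa using tendsto_const_nhds.add (hν'.mul_const (Real.sqrt (E₀ * L)))
  exact ge_of_tendsto' ht hj

/-- **Dissipation floor squared ≤ strain × energy bound squared** (`d = 3`, combining with
`dissipation_le`): if moreover `0 ≤ ε ≤ νⱼ ‖∇Uⱼ‖₂²` for some `j`, then `ε² ≤ ‖f‖₂² E₀ ≤ M E₀²` — the
steady zeroth-law numbers obey `ε ≤ E₀ √(sup|∇f|)` (`ε ≲ U³/ℓ_f`, the Doering–Foias upper bound in
its steady form). [cite: DoeringFoias2002, §3] -/
theorem dissipation_floor_sq_le {ν : ℕ → ℝ} {f : UnitAddTorus (Fin 3) → EuclideanSpace ℝ (Fin 3)}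
    {U : ℕ → UnitAddTorus (Fin 3) → EuclideanSpace ℝ (Fin 3)} {P : ℕ → UnitAddTorus (Fin 3) → ℝ}
    {E₀ M ε : ℝ} (h : ∀ j, Torus.IsSteadyNSState (ν j) f (U j) (P j)) (hf : Torus.IsSmooth f)
    (hfd : Torus.IsDivFree f) (hM : ∀ x, Real.sqrt (∑ i, ‖Torus.partialDeriv i f x‖ ^ 2) ≤ M)
    (hν₀ : Tendsto ν atTop (𝓝 0)) (hE : ∀ j, ∫ x, ‖U j x‖ ^ 2 ≤ E₀) (hε : 0 ≤ ε) {j : ℕ}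
    (hεj : ε ≤ ν j * (Torus.eGradNormSq (U j)).toReal) :
    ε ^ 2 ≤ M * E₀ ^ 2 := by
  have hE0 : 0 ≤ E₀ := (integral_nonneg fun x => sq_nonneg _).trans (hE 0)
  have h1 : ε ^ 2 ≤ (∫ x, ‖f x‖ ^ 2) * ∫ x, ‖U j x‖ ^ 2 :=
    energy_floor_of_dissipation_floor (h j) hf hε hεj
  have h2 : (∫ x, ‖f x‖ ^ 2) * ∫ x, ‖U j x‖ ^ 2 ≤ (M * E₀) * E₀ :=
    mul_le_mul (force_sq_le_strain_mul_energy_bound h hf hfd hM hν₀ hE) (hE j)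
      (integral_nonneg fun x => sq_nonneg _) (mul_nonneg ((Real.sqrt_nonneg _).trans (hM 0)) hE0)
  nlinarith

end Summit.AnomalousDissipation.AnomalousDissipation.Theorems

end
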